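import Literature.IUT.LogVolume.GenuineLogThetaPoint
import Literature.IUT.LogVolume.Corollary22ThetaClosureField
import HarnessLib

/-!
# `F ↪ F‡(P)`: every field pinned by `Cor22.IsSubThetaField P F` embeds over `F_tpd` into the theta-closure field

Mochizuki, *Inter-universal Teichmüller theory IV*, RIMS manuscript (Apr. 2020; = PRIMS **57** (2021)), Thm. 1.10 p. 22
("`F` is obtained from `F_tpd` by adjoining `√−1`, together with the fields of definition of the `(3·5)`-torsion points of
a model `E_{F_tpd}` … determined by the Legendre form"), Step (ii) p. 24 ("`Gal(F/F_tpd) ↪ GL₂(𝔽₃) × GL₂(𝔽₅) × ℤ/2ℤ`",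
`[F : F_tpd] ≤ 2·48·480`).

The pinning predicate of the genuine Θ-volume datum `Cor22.ThetaVolumeDatumAt P l` (model reading v3;
`ThetaFieldReading.lean`, abc-iut-w4-d037 → abc-iut-S2) is `Cor22.IsSubThetaField P F`: `F` is generated over `F_tpd` by
admissible generators — square roots of `−1, λ, λ−1` and coordinates of `F`-rational `15`-torsion points of `E_λ`. Its
companion `IsSubThetaField.nonempty_algHom` gives `F ↪ L` over `F_tpd` for any `L` in which the minimal polynomials of the
admissible generators split. This PROOF-ONLY file supplies exactly that splitting for **`L := F‡(P) =
Cor22.thetaClosureField P`** (abc-iut-L5-t7's `Corollary22ThetaClosureField.lean`: `F_tpd(√−1, √λ, √(λ−1), E_λ[15]) ⊆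
F̄_tpd`, Galois over `F_tpd`, of degree dividing `2²·46080`):

* `Cor22.pointCoords_map` — coordinates of a point transform under `Affine.Point.map`;
* `Cor22.algHom_mem_thetaClosureField_of_mem_generators` — under ANY `F_tpd`-embedding `ι : F → F̄_tpd`, every
  admissible generator of `F` lands in `F‡(P)` (square roots to square roots; an `F`-rational `15`-torsion point of
  `E_λ` maps to a `15`-torsion point of `E_λ(F̄_tpd)`, whose coordinates are generators of `F‡`);
* `Cor22.subThetaFieldGenerators_splits_thetaClosureField` — the hypothesis `hL` of `IsSubThetaField.nonempty_algHom`
  at `L = F‡(P)` (minimal polynomials are unchanged along `ι` and split in the NORMAL extension `F‡/F_tpd`);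
* **`Cor22.IsSubThetaField.nonempty_algHom_thetaClosureField : IsSubThetaField P F → Nonempty (F →ₐ[F_tpd] F‡(P))`**,
  **`….finrank_le_thetaClosureField`** (`[F : F_tpd] ≤ [F‡(P) : F_tpd]`) and **`….finrank_le`**
  (`[F : F_tpd] ≤ 2²·46080`); the datum forms `Cor22.ThetaVolumeDatumAt.nonempty_algHom_thetaClosureField` /
  `….finrank_le` — the degree input of [IUTchIV] Thm. 1.10 Step (ii) for EVERY genuine Θ-volume datum at `(P, l)`
  (consumers: the (ii′) tower arithmetic of abc-iut-S1/S3/c312-d1).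

Classical field theory; TAKES NO SIDE on [IUTchIII] Cor. 3.12. Deliberately NOT here: the ramification of `F/F_tpd`
(it follows from `F ↪ F‡ = F_tpd(E_λ[60])` and the division-field ramification theorems; sequel), normality over `F_mod`.
-/

noncomputable section

open scoped Classical

namespace Literature.IUT.LogVolume

namespace Cor22

open NumberField Literature.NumberTheory.DiophantineGeometry.GenEll
open Literature.NumberTheory.EllipticCurves WeierstrassCurve IntermediateField

variable (P : NFPoint)

/-! ## Coordinates under base change of points -/

/-- The coordinates of the image of a point of `E_λ` under an `F_tpd`-algebra map `ι : K → L` are the images of its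
coordinates (`O ↦ O`, `(x, y) ↦ (ι x, ι y)`). [cite: SilvermanAEC2009, VIII.§1] -/
theorem pointCoords_map {K L : Type} [Field K] [Field L] [Algebra P.F K] [Algebra P.F L] (ι : K →ₐ[P.F] L)
    (T : (P.legendreCurve.baseChange K).toAffine.Point) :
    pointCoords (Affine.Point.map (W' := P.legendreCurve.toAffine) ι T) = ι '' pointCoords T := by
  cases T with
  | zero =>
    show pointCoords ((Affine.Point.map (W' := P.legendreCurve.toAffine) ι) 0) = ι '' ∅
    rw [map_zero, Set.image_empty]
    rfl
  | some x y h =>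
    rw [Affine.Point.map_some]
    simp only [pointCoords, Set.image_insert_eq, Set.image_singleton]

/-! ## The admissible generators land in `F‡(P)` -/

variable {F : Type} [Field F] [NumberField F] [Algebra P.F F]

/-- `F` is algebraic over `F_tpd` (both are number fields). [folklore] -/
private theorem isAlgebraic_tpd : Algebra.IsAlgebraic P.F F := Algebra.IsAlgebraic.tower_top (K := ℚ) P.F

/-- **Every admissible generator of `F` lands in `F‡(P)` under any `F_tpd`-embedding `ι : F → F̄_tpd`**: a square
root of `−1, λ, λ−1` maps to a square root of the same element; a coordinate of an `F`-rational `15`-torsion point `T`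
of `E_λ` maps to a coordinate of the `15`-torsion point `ι(T) ∈ E_λ(F̄_tpd)`. [claim: Mochizuki2012, status: disputed] -/
theorem algHom_mem_thetaClosureField_of_mem_generators (ι : F →ₐ[P.F] AlgebraicClosure P.F) {x : F}
    (hx : x ∈ subThetaFieldGenerators P F) : ι x ∈ thetaClosureField P := by
  rcases hx with hx | hx
  · rcases hx with h | h | h
    · refine sqrt_mem_thetaClosureField P (a := -1) (by simp [thetaClosureRadicands]) ?_
      rw [← map_pow, h, map_neg, map_one, map_neg, map_one]
    · refine sqrt_mem_thetaClosureField P (a := P.x) (by simp [thetaClosureRadicands]) ?_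
      rw [← map_pow, h, AlgHom.commutes]
    · refine sqrt_mem_thetaClosureField P (a := P.x - 1) (by simp [thetaClosureRadicands]) ?_
      rw [← map_pow, h, map_sub, map_one, AlgHom.commutes, map_sub, map_one]
  · rw [torsionCoords_eq] at hx
    obtain ⟨T, hT, hxT⟩ := Set.mem_iUnion₂.mp hx
    have hT15 : (15 : ℤ) • T = 0 := hT
    have hT' : (15 : ℤ) • (Affine.Point.map (W' := P.legendreCurve.toAffine) ι T) = 0 := by
      rw [← map_zsmul, hT15, map_zero]
    refine coords_mem_thetaClosureField P hT' ?_
    rw [pointCoords_map]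
    exact ⟨x, hxT, rfl⟩

/-- **The minimal polynomial over `F_tpd` of every admissible generator of `F` splits in `F‡(P)`** (and the
generator is integral): transport along an embedding `ι : F → F̄_tpd` (which exists, `F/F_tpd` being algebraic) into
the NORMAL extension `F‡(P)/F_tpd`. This is the hypothesis `hL` of `IsSubThetaField.nonempty_algHom` at `L = F‡(P)`.
[claim: Mochizuki2012, status: disputed] -/
theorem subThetaFieldGenerators_splits_thetaClosureField (hU : P.InU) :
    ∀ x ∈ subThetaFieldGenerators P F,
      IsIntegral P.F x ∧ ((minpoly P.F x).map (algebraMap P.F (thetaClosureField P))).Splits := by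
  haveI : Fact P.InU := ⟨hU⟩
  intro x hx
  refine ⟨(Algebra.IsIntegral.isIntegral (R := ℚ) x).tower_top, ?_⟩
  haveI : Algebra.IsAlgebraic P.F F := isAlgebraic_tpd P
  let ι : F →ₐ[P.F] AlgebraicClosure P.F := IsAlgClosed.lift
  have hmem : ι x ∈ thetaClosureField P := algHom_mem_thetaClosureField_of_mem_generators P ι hx
  set y : thetaClosureField P := ⟨ι x, hmem⟩ with hy
  have h1 : minpoly P.F x = minpoly P.F y := by
    rw [← minpoly.algHom_eq ι ι.injective x,
      ← minpoly.algebraMap_eq (algebraMap (thetaClosureField P) (AlgebraicClosure P.F)).injective y]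
    rfl
  rw [h1]
  exact Normal.splits inferInstance y

/-! ## `F ↪ F‡(P)` and the degree bound -/

/-- **`F ↪ F‡(P)` over `F_tpd`** for every field pinned by `IsSubThetaField P F` (model reading v3: "`F_tpd ⊆ F ⊆
F‡(P)` intrinsically"). [claim: Mochizuki2012, status: disputed] -/
theorem IsSubThetaField.nonempty_algHom_thetaClosureField (hU : P.InU) (h : IsSubThetaField P F) :
    Nonempty (F →ₐ[P.F] thetaClosureField P) :=
  h.nonempty_algHom (subThetaFieldGenerators_splits_thetaClosureField P hU)

/-- **`[F : F_tpd] ≤ [F‡(P) : F_tpd]`** for every field pinned by `IsSubThetaField P F`.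
[cite: Mochizuki2012, IUTchIV Thm. 1.10 proof Step (ii) p. 24] -/
theorem IsSubThetaField.finrank_le_thetaClosureField (hU : P.InU) (h : IsSubThetaField P F) :
    Module.finrank P.F F ≤ Module.finrank P.F (thetaClosureField P) :=
  haveI : Fact P.InU := ⟨hU⟩
  h.finrank_le (subThetaFieldGenerators_splits_thetaClosureField P hU)

/-- **`[F : F_tpd] ≤ 2²·46080 = 2¹²·3²·5`** for every field pinned by `IsSubThetaField P F` (print, Step (ii) p. 24:
`[F : F_tpd] ≤ |GL₂(𝔽₃)|·|GL₂(𝔽₅)|·2 = 46080`; the cell's reading v3 adds the two quadratic twist roots).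
[cite: Mochizuki2012, IUTchIV Thm. 1.10 proof Step (ii) p. 24] -/
theorem IsSubThetaField.finrank_le_bound (hU : P.InU) (h : IsSubThetaField P F) :
    Module.finrank P.F F ≤ 2 ^ 2 * 46080 :=
  (h.finrank_le_thetaClosureField P hU).trans (Nat.le_of_dvd (by norm_num) (finrank_thetaClosureField_dvd P hU))

/-! ## At a genuine Θ-volume datum -/

namespace ThetaVolumeDatumAt

variable {P} {l : ℕ} (T : ThetaVolumeDatumAt P l)

/-- **The field `F` of every genuine Θ-volume datum at `(P, l)` embeds into `F‡(P)` over `F_tpd`.**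
[cite: Mochizuki2012, IUTchIV Thm. 1.10 p. 22] -/
theorem nonempty_algHom_thetaClosureField (hU : P.InU) :
    (letI := T.instFieldF; letI := T.instAlgebraF; Nonempty (T.F →ₐ[P.F] thetaClosureField P)) := by
  letI := T.instFieldF; letI := T.instNumberFieldF; letI := T.instAlgebraF
  exact T.isSubThetaField.nonempty_algHom_thetaClosureField P hU

/-- **`[F : F_tpd] ≤ 2²·46080` for the field of every genuine Θ-volume datum at `(P, l)`** — the degree input of
[IUTchIV] Thm. 1.10 Step (ii) at the datum. [cite: Mochizuki2012, IUTchIV Thm. 1.10 proof Step (ii) p. 24] -/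
theorem finrank_le (hU : P.InU) :
    (letI := T.instFieldF; letI := T.instAlgebraF; Module.finrank P.F T.F) ≤ 2 ^ 2 * 46080 := by
  letI := T.instFieldF; letI := T.instNumberFieldF; letI := T.instAlgebraF
  exact T.isSubThetaField.finrank_le_bound P hU

end ThetaVolumeDatumAt

/-! ## Divisibility of the degree (appended) -/

/-- **`[F : F_tpd] ∣ [F‡(P) : F_tpd]`** for every field pinned by `IsSubThetaField P F`: the tower `F_tpd ⊆ F ⊆ F‡(P)`
along the embedding of `nonempty_algHom_thetaClosureField`. [cite: Mochizuki2012, IUTchIV Thm. 1.10 proof Step (ii) p. 24] -/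
theorem IsSubThetaField.finrank_dvd_thetaClosureField (hU : P.InU) (h : IsSubThetaField P F) :
    Module.finrank P.F F ∣ Module.finrank P.F (thetaClosureField P) := by
  haveI : Fact P.InU := ⟨hU⟩
  obtain ⟨φ⟩ := h.nonempty_algHom_thetaClosureField P hU
  letI : Algebra F (thetaClosureField P) := φ.toRingHom.toAlgebra
  haveI : IsScalarTower P.F F (thetaClosureField P) :=
    IsScalarTower.of_algebraMap_eq fun x => (φ.commutes x).symm
  exact Dvd.intro _ (Module.finrank_mul_finrank P.F F (thetaClosureField P))

/-- **`[F : F_tpd] ∣ 2²·46080 = 2¹²·3²·5`** for every field pinned by `IsSubThetaField P F` (print, Step (ii) p. 24: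
`[F : F_tpd]` divides `|GL₂(𝔽₃)|·|GL₂(𝔽₅)|·2 = 46080`; two more quadratic layers in the cell's reading v3).
[cite: Mochizuki2012, IUTchIV Thm. 1.10 proof Step (ii) p. 24] -/
theorem IsSubThetaField.finrank_dvd_bound (hU : P.InU) (h : IsSubThetaField P F) :
    Module.finrank P.F F ∣ 2 ^ 12 * 3 ^ 2 * 5 := by
  have h46 : (2 : ℕ) ^ 2 * 46080 = 2 ^ 12 * 3 ^ 2 * 5 := by norm_num
  exact h46 ▸ (h.finrank_dvd_thetaClosureField P hU).trans (finrank_thetaClosureField_dvd P hU)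

namespace ThetaVolumeDatumAt

variable {P} {l : ℕ} (T : ThetaVolumeDatumAt P l)

/-- **`[F : F_tpd] ∣ 2¹²·3²·5` for the field of every genuine Θ-volume datum at `(P, l)`** — the divisibility form of
the Step (ii) degree input (abc-iut-S3's tower junction asks `∃ a ≤ 14, [F : F_tpd] ∣ 2^a·3²·5`; here `a = 12`).
[cite: Mochizuki2012, IUTchIV Thm. 1.10 proof Step (ii) p. 24] -/
theorem finrank_dvd (hU : P.InU) :
    (letI := T.instFieldF; letI := T.instAlgebraF; Module.finrank P.F T.F) ∣ 2 ^ 12 * 3 ^ 2 * 5 := by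
  letI := T.instFieldF; letI := T.instNumberFieldF; letI := T.instAlgebraF
  exact T.isSubThetaField.finrank_dvd_bound P hU

/-- The same in the shape `∃ a ≤ 14, [F : F_tpd] ∣ 2^a·3²·5` of abc-iut-S3's tower junction (with `a := 12`).
[cite: Mochizuki2012, IUTchIV Thm. 1.10 proof Step (ii) p. 24] -/
theorem exists_finrank_dvd (hU : P.InU) :
    ∃ a : ℕ, a ≤ 14 ∧ (letI := T.instFieldF; letI := T.instAlgebraF; Module.finrank P.F T.F) ∣ 2 ^ a * 3 ^ 2 * 5 :=
  ⟨12, by norm_num, T.finrank_dvd hU⟩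

end ThetaVolumeDatumAt

end Cor22

end Literature.IUT.LogVolume

end
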